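import Mathlib
import Literature.MathematicalPhysics.QuantumLattice.Imbrie2016.FlagDuality

/-!
# Share climbs are paid by the entropy  [folklore]

For the flag functional `upVar n f = ∑_{k < n-1} (f (k+1) - f k)⁺` of
`Literature.MathematicalPhysics.QuantumLattice.Imbrie2016.FlagDuality`: if `f k ≤ 0` for all
`k < n` (think `f k = log p̂_{k+1}`, the log-probabilities of the successive choices of a random
flag), then the total climb of `f` is at most `-∑_{k<n} f k` (`= -log P(σ)`, whose mean is the
entropy of the flag law).

This is the book-keeping step of DENSITY-XY G.59 (c4)/(G″.2) in the repair cell b2b-imbrie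
(seat 2): along the sequential Christoffel sampler the step ratio factorises as
`r_k = (p̂_{k+1}/p̂_k) · M_k`, and the SHARE part `∑_k log⁺(p̂_{k+1}/p̂_k)` is dominated pathwise by
`-log P_seq(σ)`, so that in the Gibbs variational bound (`StochasticFlag.gibbs_variational`) it
cancels against the entropy term.  Elementary; tagged folklore.
-/

open Finset

namespace Literature.MathematicalPhysics.QuantumLattice.Imbrie2016

/-- [folklore] One climb of a nonpositive sequence is at most minus its starting value:
`(f (k+1) - f k)⁺ ≤ -f k` when `f (k+1) ≤ 0` and `f k ≤ 0`. -/
theorem posPart_step_le_neg {a b : ℝ} (ha : a ≤ 0) (hb : b ≤ 0) : max (b - a) 0 ≤ -a := by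
  rcases le_or_gt (b - a) 0 with h | h
  · rw [max_eq_right h]; linarith
  · rw [max_eq_left h.le]; linarith

/-- [folklore] **Share climbs ≤ minus log-probability**: if `f k ≤ 0` for all `k < n` then
`upVar n f ≤ -∑_{k<n} f k`. -/
theorem upVar_le_neg_sum (n : ℕ) (f : ℕ → ℝ) (hf : ∀ k, k < n → f k ≤ 0) :
    upVar n f ≤ -∑ k ∈ range n, f k := by
  unfold upVar
  have h1 : ∑ k ∈ range (n - 1), max (f (k + 1) - f k) 0 ≤ ∑ k ∈ range (n - 1), (-f k) := by
    apply Finset.sum_le_sum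
    intro k hk
    rw [Finset.mem_range] at hk
    exact posPart_step_le_neg (hf k (by omega)) (hf (k + 1) (by omega))
  have h2 : ∑ k ∈ range (n - 1), (-f k) ≤ ∑ k ∈ range n, (-f k) := by
    apply Finset.sum_le_sum_of_subset_of_nonneg
    · intro k hk
      simp only [Finset.mem_range] at hk ⊢
      omega
    · intro k hk _
      rw [Finset.mem_range] at hk
      have := hf k hk
      linarith
  have h3 : ∑ k ∈ range n, (-f k) = -∑ k ∈ range n, f k := Finset.sum_neg_distrib ..
  linarith [h1, h2, h3.le, h3.ge]

/-- [folklore] The same with an additive split: if a flag potential satisfies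
`g k ≤ m k + (f (k+1) - f k)` stepwise (step ratio = share ratio × metric factor, in logs) with all
`f k ≤ 0`, then `∑_{k<n-1} (g k)⁺ ≤ ∑_{k<n-1} (m k)⁺ - ∑_{k<n} f k`
(the form in which (G″.2) uses it: `V_σ ≤ ∑ log⁺ M_k - log P_seq(σ)`). -/
theorem sum_posPart_le_of_split (n : ℕ) (f g m : ℕ → ℝ) (hf : ∀ k, k < n → f k ≤ 0)
    (hg : ∀ k, k + 1 < n → g k ≤ m k + (f (k + 1) - f k)) :
    ∑ k ∈ range (n - 1), max (g k) 0
      ≤ ∑ k ∈ range (n - 1), max (m k) 0 - ∑ k ∈ range n, f k := by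
  have h1 : ∑ k ∈ range (n - 1), max (g k) 0
      ≤ ∑ k ∈ range (n - 1), (max (m k) 0 + max (f (k + 1) - f k) 0) := by
    apply Finset.sum_le_sum
    intro k hk
    rw [Finset.mem_range] at hk
    have hgk := hg k (by omega)
    have hm : m k ≤ max (m k) 0 := le_max_left _ _
    have hs : f (k + 1) - f k ≤ max (f (k + 1) - f k) 0 := le_max_left _ _
    have h0m : 0 ≤ max (m k) 0 := le_max_right _ _
    have h0s : 0 ≤ max (f (k + 1) - f k) 0 := le_max_right _ _
    exact max_le (by linarith) (by linarith)
  rw [Finset.sum_add_distrib] at h1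
  have h2 := upVar_le_neg_sum n f hf
  unfold upVar at h2
  linarith

end Literature.MathematicalPhysics.QuantumLattice.Imbrie2016
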